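import Literature.Analysis.FunctionSpaces.SobolevSmoothUpToBoundary
import Literature.Analysis.FunctionSpaces.SobolevTraceProofs
import Literature.Analysis.FunctionSpaces.SobolevTraceEmbeddingProofs
import Literature.Analysis.FunctionSpaces.HolderNorm
import HarnessLib

/-!
# `⋂ₖ W^{k,2}(Ω)` consists of functions smooth up to the boundary: bounded Lipschitz `Ω ⊂ ℝ⁴`
# (and `W^{m+1,p}(ℝⁿ) ⊂ C^m(ℝⁿ)` for `p > n`)

Analysis/FunctionSpaces support file (all results proved, no definitions, no named facts): the
four-dimensional companion of `SobolevSmoothUpToBoundary.lean` (which is written for `n = 3`),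
needed for the boundary regularity of the Neumann problem in the charts of a four-manifold
(`Analysis/PDE/NeumannHalfBall*`, discharge path of
`Literature.Geometry.Riemannian.sharpLogSobolevAVR_four`). The chain (R. A. Adams, *Sobolev
Spaces* (1975), Thm 5.4 and Remark 5.5 (4); Evans, *PDE*, §5.6.3 Thm 6) is assembled from
dimension-free pieces of the tree:

* `exists_contDiff_rep_of_memSobolevDomain_top_of_lt` — **`W^{m+1,p}(ℝⁿ) ⊂ C^m(ℝⁿ)` for
  `n < p < ∞`**, any dimension: base case Morrey's embedding (`morrey_embedding_holds`,
  `MemBoundedHolder.continuous`), inductive step as in `exists_contDiff_rep_of_memSobolevDomain`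
  (continuous weak derivatives are classical, `HasWeakFDerivOn.hasFDerivAt_of_continuousOn`);
* `memSobolevDomain_gnsStep` — one Gagliardo–Nirenberg–Sobolev step on a bounded Lipschitz domain,
  `W^{k+1,p}(Ω) ⊂ W^{k,p*}(Ω)` (`exists_eLpNorm_le_of_memSobolevDomain_one`), and
  `memSobolevDomain_mono_exponent` (`W^{k,p}(Ω) ⊂ W^{k,q}(Ω)`, `q ≤ p`, bounded `Ω`);
* `exists_contDiff_rep_of_forall_memSobolevDomain_four` — on a bounded Lipschitz domain of a
  FOUR-dimensional space, `W^{m+3,2}(Ω) ⊂ W^{m+2,4} ⊂ W^{m+2,3} ⊂ W^{m+1,12}(Ω)`, Stein's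
  extension (`stein_extension_holds`) to `W^{m+1,12}(ℝ⁴)`, and `12 > 4`;
* `exists_contDiffOn_closure_of_forall_memSobolevDomain_four` — one representative continuous on
  `ℝ⁴` and `C^∞` on `closure Ω` (as in the three-dimensional file).

## References

* R. A. Adams, *Sobolev Spaces*, Academic Press (1975), Thm 5.4 Parts I–II, Remark 5.5 (4).
  [Adams1975]
* L. C. Evans, *Partial Differential Equations*, 2nd ed. (2010), §5.6.2 Thm 5, §5.6.3 Thm 6.
  [Evans2010]
-/

noncomputable section

open MeasureTheory Metric Set Filter Topology Module TopologicalSpace Function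
open scoped ENNReal NNReal ContDiff RealInnerProductSpace

namespace Literature.Analysis.FunctionSpaces

variable {E' : Type*} [NormedAddCommGroup E'] [InnerProductSpace ℝ E'] [FiniteDimensional ℝ E']
  [MeasurableSpace E'] [BorelSpace E'] {μ : Measure E'} [μ.IsAddHaarMeasure]
variable {F : Type*} [NormedAddCommGroup F] [NormedSpace ℝ F] [FiniteDimensional ℝ F]

/-! ### `W^{m+1,p}(ℝⁿ) ⊂ C^m(ℝⁿ)` for `p > n` -/

/-- **`W^{m+1,p}(ℝⁿ) ⊂ C^m(ℝⁿ)` for `n < p < ∞`** (Evans, *PDE*, §5.6.3 Thm 6 (ii); Adams, Thm 5.4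
Part II): a function with `MemSobolevDomain (m+1) p ⊤` agrees a.e. with a `C^m` function.
Induction on `m`: `m = 0` is Morrey's embedding (`morrey_embedding_holds`); in the step the function
and the components of its weak derivative have `C^m` representatives, which assemble to a
continuous weak, hence classical, derivative. [cite: Evans2010, §5.6.3 Theorem 6] -/
theorem exists_contDiff_rep_of_memSobolevDomain_top_of_lt {p : ℝ≥0∞}
    (hp : (finrank ℝ E' : ℝ) < p.toReal) (hp' : p ≠ ⊤) (m : ℕ) :
    ∀ {f : E' → F}, MemSobolevDomain (m + 1) p ⊤ μ f →
      ∃ f' : E' → F, f =ᵐ[μ] f' ∧ ContDiff ℝ m f' := by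
  haveI : CompleteSpace F := FiniteDimensional.complete ℝ F
  induction m with
  | zero =>
    intro f hf
    obtain ⟨g, hgf, hg⟩ := morrey_embedding_holds (E := E') (F := F) hp hp' μ hf
    have hr : 0 < Real.toNNReal (1 - finrank ℝ E' / p.toReal) := by
      rw [Real.toNNReal_pos, sub_pos, div_lt_one ((Nat.cast_nonneg _).trans_lt hp)]
      exact hp
    exact ⟨g, hgf.symm, contDiff_zero.2 (hg.continuous hr)⟩
  | succ m ih =>
    intro f hf
    have hfm : MemSobolevDomain (m + 1) p ⊤ μ f := memSobolevDomain_of_succ_order hf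
    obtain ⟨-, g, hw, hcomp⟩ := hf
    obtain ⟨f', hff', hf'c⟩ := ih hfm
    set b := stdOrthonormalBasis ℝ E' with hb
    have hgi : ∀ i, ∃ gi : E' → F, (fun x => g x (b i)) =ᵐ[μ] gi ∧ ContDiff ℝ m gi :=
      fun i => ih (hcomp (b i))
    choose gi hgi hgic using hgi
    set G : E' → E' →L[ℝ] F := fun x => ∑ i, (innerSL ℝ (b i)).smulRight (gi i x) with hG
    have hGc : ContDiff ℝ m G :=
      ContDiff.sum fun i _ => (ContinuousLinearMap.smulRightL ℝ E' F (innerSL ℝ (b i))).contDiff.comp (hgic i)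
    have hgG : g =ᵐ[μ] G := by
      have hall : ∀ᵐ x ∂μ, ∀ i, g x (b i) = gi i x := ae_all_iff.2 fun i => hgi i
      filter_upwards [hall] with x hx
      ext v
      calc g x v = g x (∑ i, ⟪b i, v⟫ • b i) := by rw [b.sum_repr' v]
        _ = ∑ i, ⟪b i, v⟫ • g x (b i) := by simp [map_sum, map_smul]
        _ = G x v := by simp [hG, hx, ContinuousLinearMap.smulRight_apply]
    have hw' : HasWeakFDerivOn ⊤ μ f' G := by
      refine MeyersSerrin.hasWeakFDerivOn_congr_ae hw ?_ ?_
      · have : (μ.restrict ((⊤ : Opens E') : Set E')) = μ := by simp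
        rw [this]; exact hff'.symm
      · have : (μ.restrict ((⊤ : Opens E') : Set E')) = μ := by simp
        rw [this]; exact hgG.symm
    have hderiv : ∀ x, HasFDerivAt f' (G x) x := fun x =>
      hw'.hasFDerivAt_of_continuousOn hf'c.continuous.continuousOn hGc.continuous.continuousOn
        (Set.mem_univ x)
    refine ⟨f', hff', ?_⟩
    rw [show ((m + 1 : ℕ) : WithTop ℕ∞) = (m : WithTop ℕ∞) + 1 by push_cast; ring]
    exact contDiff_succ_iff_hasFDerivAt.2 ⟨G, hGc, hderiv⟩

/-! ### Exponent bootstrap on bounded Lipschitz domains -/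

omit [InnerProductSpace ℝ E'] [FiniteDimensional ℝ E'] [BorelSpace E'] [μ.IsAddHaarMeasure]
  [FiniteDimensional ℝ F] in
/-- Dropping several orders of a Sobolev function. [folklore] -/
theorem memSobolevDomain_of_le_order [NormedSpace ℝ E'] {Ω : Opens E'} {p : ℝ≥0∞} {f : E' → F} :
    ∀ {m n : ℕ}, m ≤ n → MemSobolevDomain n p Ω μ f → MemSobolevDomain m p Ω μ f
  | m, n, hmn, hf => by
    induction n generalizing m with
    | zero => rwa [Nat.le_zero.1 hmn]
    | succ n ih =>
      rcases Nat.lt_or_ge m (n + 1) with h | h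
      · exact ih _ (Nat.lt_succ_iff.1 h) (memSobolevDomain_of_succ_order hf)
      · rwa [le_antisymm hmn h]


omit [FiniteDimensional ℝ F] in
/-- **One Gagliardo–Nirenberg–Sobolev step on a bounded Lipschitz domain**:
`W^{k+1,p}(Ω) ⊂ W^{k,p*}(Ω)` for `1 ≤ p < n`, `1/p* = 1/p - 1/n` (Adams, Thm 5.4 Part I Case C
applied to all derivatives; the tree's `exists_eLpNorm_le_of_memSobolevDomain_one`).
[cite: Adams1975, Thm 5.4 Part I Case C] -/
theorem memSobolevDomain_gnsStep [CompleteSpace F] {Ω : Opens E'} (hΩ : IsLipschitzDomain Ω)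
    (hb : Bornology.IsBounded (Ω : Set E')) {p p' : ℝ≥0} (hp : 1 ≤ p)
    (hpn : (p : ℝ) < finrank ℝ E') (hp' : (p' : ℝ)⁻¹ = (p : ℝ)⁻¹ - (finrank ℝ E' : ℝ)⁻¹) (k : ℕ) :
    ∀ {f : E' → F}, MemSobolevDomain (k + 1) p Ω μ f → MemSobolevDomain k p' Ω μ f := by
  obtain ⟨C, hC⟩ := exists_eLpNorm_le_of_memSobolevDomain_one (F := F) hΩ hb hp hpn hp' μ
  have hp1 : (1 : ℝ≥0∞) ≤ p := by exact_mod_cast hp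
  -- the order-one embedding as a `MemLp` statement
  have hbase : ∀ {f : E' → F}, MemSobolevDomain 1 p Ω μ f → MemLp f p' (μ.restrict Ω) :=
    fun {f} hf => by
      obtain ⟨h0, g, hg, hgk⟩ := hf
      have hf1 : MemSobolevDomain 1 p Ω μ f := ⟨h0, g, hg, hgk⟩
      refine ⟨h0.1, lt_of_le_of_lt (hC f g hf1 hg) ?_⟩
      refine ENNReal.mul_lt_top ENNReal.coe_lt_top (ENNReal.add_lt_top.2 ⟨h0.2, ?_⟩)
      set b := Module.finBasis ℝ E'
      obtain ⟨C₁, -, hC₁⟩ := exists_opNorm_le_mul_sum_basis (F := F) b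
      have hgm : AEStronglyMeasurable g (μ.restrict Ω) :=
        hg.locallyIntegrableOn_deriv.aestronglyMeasurable
      refine lt_of_le_of_lt (eLpNorm_le_mul_sum_eLpNorm_apply_basis b hC₁ hgm hp1) ?_
      refine ENNReal.mul_lt_top ENNReal.coe_lt_top ?_
      exact ENNReal.sum_lt_top.2 fun i _ => (memSobolevDomain_zero_iff.1 (hgk (b i))).2
  induction k with
  | zero => intro f hf; exact memSobolevDomain_zero_iff.2 (hbase hf)
  | succ k ih =>
    intro f hf
    have hf1 : MemSobolevDomain 1 p Ω μ f :=
      memSobolevDomain_of_le_order (Nat.le_add_left 1 (k + 1)) hf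
    obtain ⟨-, g, hg, hgk⟩ := hf
    exact ⟨hbase hf1, g, hg, fun v => ih (hgk v)⟩

omit [FiniteDimensional ℝ E'] [BorelSpace E'] [μ.IsAddHaarMeasure] [FiniteDimensional ℝ F] in
/-- `W^{k,p}(Ω) ⊂ W^{k,q}(Ω)` for `q ≤ p` on a set of finite measure (Hölder). [folklore] -/
theorem memSobolevDomain_mono_exponent {Ω : Opens E'} (hΩ : μ Ω ≠ ⊤) {p q : ℝ≥0∞} (hqp : q ≤ p)
    (k : ℕ) : ∀ {f : E' → F}, MemSobolevDomain k p Ω μ f → MemSobolevDomain k q Ω μ f := by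
  haveI : IsFiniteMeasure (μ.restrict (Ω : Set E')) :=
    ⟨by rw [Measure.restrict_apply_univ]; exact hΩ.lt_top⟩
  induction k with
  | zero => intro f hf; exact memSobolevDomain_zero_iff.2 ((memSobolevDomain_zero_iff.1 hf).mono_exponent hqp)
  | succ k ih =>
    intro f hf
    obtain ⟨h0, g, hg, hgk⟩ := hf
    exact ⟨h0.mono_exponent hqp, g, hg, fun v => ih (hgk v)⟩

/-! ### Dimension four -/

/-- **`⋂ₖ W^{k,2}(Ω) ⊂ C^m` on bounded Lipschitz domains of `ℝ⁴`, representative form**: if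
`finrank ℝ E' = 4`, `Ω` is a bounded Lipschitz domain and `f ∈ W^{m+3,2}(Ω)`, then `f` agrees a.e.
on `Ω` with a globally `C^m` function: `W^{m+3,2}(Ω) ⊂ W^{m+2,4}(Ω) ⊂ W^{m+2,3}(Ω) ⊂ W^{m+1,12}(Ω)`
(two GNS steps and Hölder), Stein's extension to `W^{m+1,12}(ℝ⁴)`, and `12 > 4`
(`exists_contDiff_rep_of_memSobolevDomain_top_of_lt`). [cite: Adams1975, Thm 5.4 and Remark 5.5 (4)] -/
theorem exists_contDiff_rep_of_memSobolevDomain_lipschitz_four (hE : finrank ℝ E' = 4)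
    {Ω : Opens E'} (hΩ : IsLipschitzDomain Ω) (hb : Bornology.IsBounded (Ω : Set E')) (m : ℕ)
    {f : E' → F} (hf : MemSobolevDomain (m + 3) 2 Ω μ f) :
    ∃ f' : E' → F, f =ᵐ[μ.restrict Ω] f' ∧ ContDiff ℝ m f' := by
  haveI : CompleteSpace F := FiniteDimensional.complete ℝ F
  have hΩfin : μ Ω ≠ ⊤ := hb.measure_lt_top.ne
  -- `W^{m+3,2} ⊂ W^{m+2,4}`
  have h2 : MemSobolevDomain (m + 2 + 1) (2 : ℝ≥0) Ω μ f := by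
    have : ((2 : ℝ≥0) : ℝ≥0∞) = 2 := by norm_num
    rw [this]; exact hf
  have h4 : MemSobolevDomain (m + 2) (4 : ℝ≥0) Ω μ f :=
    memSobolevDomain_gnsStep hΩ hb (p := 2) (p' := 4) (by norm_num) (by rw [hE]; norm_num)
      (by rw [hE]; push_cast; norm_num) (m + 2) h2
  -- `W^{m+2,4} ⊂ W^{m+2,3}`
  have h3 : MemSobolevDomain (m + 1 + 1) (3 : ℝ≥0) Ω μ f := by
    have h := memSobolevDomain_mono_exponent hΩfin (p := ((4 : ℝ≥0) : ℝ≥0∞))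
      (q := ((3 : ℝ≥0) : ℝ≥0∞)) (by norm_num) (m + 2) h4
    simpa only [show m + 2 = m + 1 + 1 from rfl] using h
  -- `W^{m+2,3} ⊂ W^{m+1,12}`
  have h12 : MemSobolevDomain (m + 1) (12 : ℝ≥0) Ω μ f :=
    memSobolevDomain_gnsStep hΩ hb (p := 3) (p' := 12) (by norm_num) (by rw [hE]; norm_num)
      (by rw [hE]; push_cast; norm_num) (m + 1) h3
  -- Stein extension and the whole-space embedding
  obtain ⟨ext, C, -, -, hext⟩ := stein_extension_holds (E' := E') (F := F) hΩ hb (m + 1)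
    ((12 : ℝ≥0) : ℝ≥0∞) (by norm_num) μ
  obtain ⟨heq, hmem, -⟩ := hext f h12
  obtain ⟨f', hff', hf'c⟩ := exists_contDiff_rep_of_memSobolevDomain_top_of_lt (μ := μ)
    (p := ((12 : ℝ≥0) : ℝ≥0∞)) (by rw [hE]; norm_num) ENNReal.coe_ne_top m hmem
  refine ⟨f', ?_, hf'c⟩
  have h1 : f =ᵐ[μ.restrict Ω] ext f :=
    ae_restrict_of_forall_mem Ω.isOpen.measurableSet fun x hx => (heq hx).symm
  exact h1.trans (ae_restrict_of_ae hff')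

/-- **Functions in `⋂ₖ W^{k,2}(Ω)` are smooth up to the boundary** (bounded Lipschitz `Ω` in a
four-dimensional inner product space): there is one function, continuous on `E'` and `C^∞` on
`closure Ω` (for every `m` equal on `closure Ω` to a globally `C^m` function), which agrees with
`f` a.e. on `Ω`. [cite: Evans2010, §5.6.3 Theorem 6 (remark on C^∞(Ū))] -/
theorem exists_contDiffOn_closure_of_forall_memSobolevDomain_four (hE : finrank ℝ E' = 4)
    {Ω : Opens E'} (hΩ : IsLipschitzDomain Ω) (hb : Bornology.IsBounded (Ω : Set E')) {f : E' → F}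
    (hf : ∀ k, MemSobolevDomain k 2 Ω μ f) :
    ∃ f' : E' → F, f =ᵐ[μ.restrict Ω] f' ∧ Continuous f' ∧ ContDiffOn ℝ ∞ f' (closure Ω) ∧
      ∀ m : ℕ, ∃ g : E' → F, ContDiff ℝ m g ∧ EqOn f' g (closure Ω) := by
  obtain ⟨f₀, hf₀, hf₀c⟩ :=
    exists_contDiff_rep_of_memSobolevDomain_lipschitz_four (μ := μ) hE hΩ hb 0 (hf 3)
  have hcont : Continuous f₀ := hf₀c.continuous
  have hreps : ∀ m : ℕ, ∃ g : E' → F, ContDiff ℝ m g ∧ EqOn f₀ g (closure Ω) := fun m => by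
    obtain ⟨g, hfg, hgc⟩ :=
      exists_contDiff_rep_of_memSobolevDomain_lipschitz_four (μ := μ) hE hΩ hb m (hf (m + 3))
    refine ⟨g, hgc, ?_⟩
    have hae : f₀ =ᵐ[μ.restrict Ω] g := hf₀.symm.trans hfg
    have hopen : EqOn f₀ g Ω :=
      Measure.eqOn_open_of_ae_eq hae Ω.isOpen hcont.continuousOn hgc.continuous.continuousOn
    exact hopen.closure hcont hgc.continuous
  refine ⟨f₀, hf₀, hcont, ?_, hreps⟩
  rw [contDiffOn_infty]
  intro n
  obtain ⟨g, hgc, hfg⟩ := hreps n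
  exact hgc.contDiffOn.congr fun x hx => hfg hx

end Literature.Analysis.FunctionSpaces

end
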